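import Summits.ResolutionOfSingularities.ResolutionOfSingularities.Theorems.FrobeniusLadderFRationalResolutionFixedChartOfRoot
import Summits.ResolutionOfSingularities.ResolutionOfSingularities.Theorems.FrobeniusLadderFRationalResolutionRootAdjoinRegularOfDerivation
import HarnessLib

/-!
# Crux `FrobeniusLadder.FRationalResolution` (stmt-ResolutionOfSingularities-15317), line `redirect`,
# stub `stub_diagonalizableQuotientResolution` — item (F2), the «additive character» case UNCONDITIONALLY: a point whose unit
# subgroup `B` becomes `A` together with one degree `a`, `d • a = deg u` for a homogeneous `u ∉ 𝔔` whose degree admits an additive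
# character `χ : A →+ k` with `χ (deg u) ≠ 0`, is the image of a FIXED point of a quotient chart of the same shape and invariants

`…FixedChartOfRoot.exists_fixed_chart_of_rootAdjoin` (p841448) re-charts such points modulo `hreg` (regularity of
`S̃ = AdjoinRoot (X^d − C u)` at the primes over the point); `…RootAdjoinRegularOfDerivation.isRegularLocalRing_localization_
adjoinRoot_of_addChar` (p841492) discharges `hreg` from the Euler derivation `θ_χ` (`θ_χ u = χ(b) u` is a unit at the point, and a
derivation not vanishing on `u` forces `X^d − u ∉ 𝔓'^{(2)}`). Composition:

* ★★★★ `exists_fixed_chart_of_addChar` — chart `(A, S, 𝒮, φ)` of hq's shape (`S` regular), point `v`, prime `𝔔` over `v` with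
  unit-degree subgroup `B`, `u ∈ S_b ∖ 𝔔`, `d • a = b` (`d ≥ 2`), `B ⊔ ⟨a⟩ = ⊤`, `j • a ∉ B` (`0 < j < d`), and `χ : A →+ k` with
  `χ b ≠ 0` ⇒ a chart of the same shape (regular, finite type, étale, same structure maps) with a FIXED prime over a point `v'`
  mapping to `φ v`. No tameness; in characteristic `p` the character exists iff `b ∉ pA` — e.g. `A = ℤ/p ⊕ ℤ/p³`, `B = ⟨(1,p)⟩`
  (neither tame nor a direct summand).

Together with `…FixedChart` (tame), `…FixedChartOfSummand` (direct summands) this leaves of item (F2) exactly the points with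
`B_𝔔 ≤ pA` after the reductions (MEMO-15317-leafhand2-g21 §3: the embedding-dimension count). Honest label: helper toward ONE
leaf stub; no stub, crux or summit closed. No definitions, no named facts, no sorry. [folklore; cite: SGA3, Exp. VIII §4–5]
[cite: Matsumura1987, Thm. 14.2; §25; §30, Cor. to Thm. 30.5] [cite: StacksProject, Tag 07NG]
-/

noncomputable section

-- single-problem summit: the doubled namespace component is forced
set_option linter.dupNamespace false

open CategoryTheory AlgebraicGeometry
open Literature.AlgebraicGeometry.Resolution

namespace Summit.ResolutionOfSingularities.ResolutionOfSingularities.Theorems.FRationalResolution.FixedChartOfAddChar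

/-- ★★★★ **Item (F2), additive-character case, unconditionally.** See the module docstring.
[folklore; cite: SGA3, Exp. VIII §4–5] [cite: Matsumura1987, Thm. 14.2; §25; §30, Cor. to Thm. 30.5] -/
theorem exists_fixed_chart_of_addChar (k : Type) [Field k] (X : Scheme.{0}) (g : X ⟶ Spec (.of k))
    (A : Type) [AddCommGroup A] [Finite A] [DecidableEq A] (S : Type) [CommRing S] [Algebra k S]
    (𝒮 : A → Submodule k S) [GradedAlgebra 𝒮] [Algebra.FiniteType k S] [IsRegularRing S]
    (φ : Spec (.of (𝒮 0)) ⟶ X) [Etale φ]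
    (hφg : φ ≫ g = Spec.map (CommRingCat.ofHom (algebraMap k (𝒮 0))))
    (v : Spec (.of (𝒮 0))) (𝔔 : Ideal S) [𝔔.IsPrime] (h𝔔v : 𝔔.comap (algebraMap (𝒮 0) S) = v.asIdeal)
    (B : AddSubgroup A) (hB : ∀ i : A, i ∈ B ↔ ∃ s ∈ 𝒮 i, s ∉ 𝔔)
    (u : S) (b : A) (hu : u ∈ 𝒮 b) (huQ : u ∉ 𝔔) (a : A) (d : ℕ) (hd : 1 < d) (hab : d • a = b)
    (hgen : B ⊔ AddSubgroup.zmultiples a = ⊤) (hmin : ∀ j : ℕ, 0 < j → j < d → j • a ∉ B)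
    (χ : A →+ k) (hχ : χ b ≠ 0) :
    ∃ (A' : Type) (_ : AddCommGroup A') (_ : Finite A') (_ : DecidableEq A')
      (S' : Type) (_ : CommRing S') (_ : Algebra k S') (𝒮' : A' → Submodule k S')
      (_ : GradedAlgebra 𝒮'),
      Algebra.FiniteType k S' ∧ IsRegularRing S' ∧
      ∃ (φ' : Spec (.of (𝒮' 0)) ⟶ X), Etale φ' ∧
        φ' ≫ g = Spec.map (CommRingCat.ofHom (algebraMap k (𝒮' 0))) ∧
        ∃ (v' : Spec (.of (𝒮' 0))) (𝔔' : Ideal S') (_ : 𝔔'.IsPrime),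
          𝔔'.comap (algebraMap (𝒮' 0) S') = v'.asIdeal ∧
          (∀ c : A', c ≠ 0 → ∀ s ∈ 𝒮' c, s ∈ 𝔔') ∧ φ' v' = φ v := by
  have hA : AddMonoid.IsTorsion A := fun i => isOfFinAddOrder_of_finite i
  exact FixedChartOfRoot.exists_fixed_chart_of_rootAdjoin k X g A S 𝒮 φ hφg v 𝔔 h𝔔v B hB u b hu huQ a d hd hab hgen hmin
    fun 𝔓 _ h𝔓 => RootAdjoinRegularOfDerivation.isRegularLocalRing_localization_adjoinRoot_of_addChar 𝒮 hA hu 𝔔 huQ χ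
      (isUnit_iff_ne_zero.2 hχ) d 𝔓 (h𝔓.trans h𝔔v.symm)

end Summit.ResolutionOfSingularities.ResolutionOfSingularities.Theorems.FRationalResolution.FixedChartOfAddChar

end
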